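import Literature.IUT.LogThetaLattice.PacketLogVolumesHaarModelRelativeTensor
import Literature.IUT.LogThetaLattice.PacketLogVolumesHaarModelCapsulesPerm
import HarnessLib

/-!
# [IUTchIII] Proposition 3.9 (i)/(iii) for CAPSULES at the RELATIVE genuine model, III: invariance of `μ^log_{A,v_ℚ}` and
# `μ^log_{A,𝕍_ℚ}` under PERMUTATIONS of the label set `A`, for the `A`-packets `⊕_{(v_β)} ⊗_β K_{v̲_β}` of `K ⊋ F_mod`
# (abc-iut cell, layer L6; row REL39, part R3 «Perm», pattern abc-iut-L6-d3's p420491)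

S. Mochizuki, *Inter-universal Teichmüller theory III*, kurims manuscript (May 2020) [claim: Mochizuki2012, status:
disputed]. Proposition 3.9 (i), p. 116: "we conclude that `μ^log_{A,v_ℚ}` is invariant with respect to permutations of `A`";
(iii), p. 117: the global log-volume `μ^log_{A,𝕍_ℚ}` "is invariant with respect to multiplication by elements of
`(†𝕄⊛_mod)_α` … as well as with respect to permutations of `A`". Dupuy–Hilado, arXiv:2004.13228, §4.7 "(Ind1)": the factor
permutation on `K_{v̲_0} ⊗ ⋯ ⊗ K_{v̲_j}` "fixes the lattice".

WHAT THIS FILE ADDS. abc-iut-L6-d3's `PacketLogVolumesHaarModelCapsulesPerm.lean` (p420491) proves the permutation clause at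
the genuine `A`-packets in the case `K = F_mod = F`; its measure-transport theorems (`haar_image_perm`,
`tensorLogVolume_image_perm` for ANY family of local fields of the cell's class; `volume_image_archPerm`,
`packetLogVol_image_archPerm`) and its bookkeeping (`portionPerm`, `portionWeight_portionPerm`) apply verbatim to the
RELATIVE portions `⊗_β K_{v̲_β}` of part I (`PacketLogVolumesHaarModelRelativeTensor.lean`, this seat). Here:
* `relPermIso ρ q π : X_{ρ·π} → X_π` — the factor permutation of the relative portion carriers (campaign-S `permAlgEquiv`
  on `⊗_α K_{v̲_{ρ α}} → ⊗_α K_{v̲_α}`; `archPermAlgEquiv` at `∞`), `isAdm_image_relPermIso`, `logVol_image_relPermIso`;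
* `relPermRegion ρ q T` (`(ρ·T)_π = perm_ρ(T_{ρ·π})`) and **`relCapsulePacketLogVolume_relPermRegion :
  μ^log_{A,v_ℚ}(ρ·T) = μ^log_{A,v_ℚ}(T)`**;
* `relPermGlobalRegion ρ S` and **`globalLogVolume_relPermGlobalRegion : μ^log_{A,𝕍_ℚ}(ρ·S) = μ^log_{A,𝕍_ℚ}(S)`**, and both
  symmetries of (iii) together with part I's `prop39iii_invariance_haarModelRelCapsules`.

HONEST SCOPE. As part I (`⊗_ℝ` of copies of `ℂ` at `∞`, faithful for totally complex `K`; regions = all positive-finite-volume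
subsets; dimension-normalised log-volumes). Classical (Haar / Lebesgue measure transport); nothing here bears on [IUTchIII]
Cor. 3.12 or takes a side; typed ≠ endorsed. [cite: DupuyHilado2025, §4.7]
-/

noncomputable section

namespace Literature.IUT.LogThetaLattice

open Literature.IUT.LogVolume Literature.IUT.LogVolume.Prop15iii NumberField IsDedekindDomain MeasureTheory Set
open scoped ENNReal NNReal

variable {F K : Type} [Field F] [NumberField F] [Field K] [NumberField K] [Algebra F K]
  (σ : PlaceSection F K) (τ : InfinitePlace F → InfinitePlace K) (hτ : ∀ w, (τ w).comap (algebraMap F K) = w)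
variable (A : Type) [Fintype A] [DecidableEq A] [Nonempty A]

/-- **The factor permutation of the relative portion carriers**, `X_{ρ·π} → X_π`: at `∞` the `ℝ`-algebra automorphism
`archPermAlgEquiv` of `⊗_{α,ℝ}ℂ`; at `p` campaign-S's `permAlgEquiv` from `⊗_α K_{v̲_{ρ α}}` onto `⊗_α K_{v̲_α}`.
[claim: Mochizuki2012, status: disputed] -/
def relPermIso (ρ : Equiv.Perm A) :
    (q : RatPlace) → (π : Portion F A q) →
      (relPortionDatum σ τ A q (portionPerm F A q ρ π)).X → (relPortionDatum σ τ A q π).X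
  | Sum.inl (), _ => fun x => archPermAlgEquiv A Unit ρ x
  | Sum.inr p, π => fun x =>
      haveI : Fact (p : ℕ).Prime := ⟨p.2⟩
      permAlgEquiv p (fun β => Kp K p (liftTuple σ A p (fun β => packetPrimeEquiv F p (π β)) β)) ρ x

/-- The factor permutation preserves admissibility (positive finite volume: d3's `volume_image_archPerm` /
`haar_image_perm` on the `K`-slots). [claim: Mochizuki2012, status: disputed] -/
theorem isAdm_image_relPermIso (ρ : Equiv.Perm A) (q : RatPlace) (π : Portion F A q)
    {T : Set (relPortionDatum σ τ A q (portionPerm F A q ρ π)).X}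
    (hT : (relPortionDatum σ τ A q (portionPerm F A q ρ π)).IsAdm T) :
    (relPortionDatum σ τ A q π).IsAdm (relPermIso σ τ A ρ q π '' T) := by
  rcases q with ⟨⟩ | p
  · haveI : Nonempty Unit := ⟨()⟩
    change volume ((canonicalDecomposition A Unit : MI A Unit → (Idx A Unit → ℂ)) ''
        ((fun x => archPermAlgEquiv A Unit ρ x) '' T)) ≠ 0 ∧
      volume ((canonicalDecomposition A Unit : MI A Unit → (Idx A Unit → ℂ)) ''
        ((fun x => archPermAlgEquiv A Unit ρ x) '' T)) ≠ ∞
    rw [show (fun x => archPermAlgEquiv A Unit ρ x) '' T = archPermAlgEquiv A Unit ρ '' T from rfl,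
      volume_image_archPerm]
    exact hT
  · haveI : Fact (p : ℕ).Prime := ⟨p.2⟩
    change 0 < (integerStructure p (fun β => Kp K p (liftTuple σ A p (fun β => packetPrimeEquiv F p (π β)) β))).haar
        ((fun x => permAlgEquiv p (fun β => Kp K p (liftTuple σ A p (fun β => packetPrimeEquiv F p (π β)) β)) ρ x) '' T) ∧
      (integerStructure p (fun β => Kp K p (liftTuple σ A p (fun β => packetPrimeEquiv F p (π β)) β))).haar
        ((fun x => permAlgEquiv p (fun β => Kp K p (liftTuple σ A p (fun β => packetPrimeEquiv F p (π β)) β)) ρ x) '' T)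
        < ∞
    rw [show (fun x => permAlgEquiv p (fun β => Kp K p (liftTuple σ A p (fun β => packetPrimeEquiv F p (π β)) β)) ρ x) '' T =
        permAlgEquiv p (fun β => Kp K p (liftTuple σ A p (fun β => packetPrimeEquiv F p (π β)) β)) ρ '' T from rfl,
      haar_image_perm]
    exact hT

/-- **The factor permutation preserves the portion log-volume**: `μ^log_π(perm_ρ T) = μ^log_{ρ·π}(T)` (d3's
`packetLogVol_image_archPerm` / `tensorLogVolume_image_perm` on the `K`-slots). [claim: Mochizuki2012, status: disputed] -/
theorem logVol_image_relPermIso (ρ : Equiv.Perm A) (q : RatPlace) (π : Portion F A q)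
    (T : Set (relPortionDatum σ τ A q (portionPerm F A q ρ π)).X) :
    (relPortionDatum σ τ A q π).logVol (relPermIso σ τ A ρ q π '' T) =
      (relPortionDatum σ τ A q (portionPerm F A q ρ π)).logVol T := by
  rcases q with ⟨⟩ | p
  · change packetLogVol (canonicalDecomposition A Unit) ((fun x => archPermAlgEquiv A Unit ρ x) '' T) =
      packetLogVol (canonicalDecomposition A Unit) T
    exact packetLogVol_image_archPerm ρ (canonicalDecomposition A Unit) T
  · haveI : Fact (p : ℕ).Prime := ⟨p.2⟩
    change tensorLogVolume p (fun β => Kp K p (liftTuple σ A p (fun β => packetPrimeEquiv F p (π β)) β))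
        ((fun x => permAlgEquiv p (fun β => Kp K p (liftTuple σ A p (fun β => packetPrimeEquiv F p (π β)) β)) ρ x) '' T) =
      tensorLogVolume p (fun α => Kp K p (liftTuple σ A p (fun β => packetPrimeEquiv F p (π β)) (ρ α))) T
    exact tensorLogVolume_image_perm p (fun β => Kp K p (liftTuple σ A p (fun β => packetPrimeEquiv F p (π β)) β)) ρ T

/-- **The permuted region** `ρ·T` of the relative `A`-packet at `v_ℚ`: `(ρ·T)_π := perm_ρ(T_{ρ·π})`.
[claim: Mochizuki2012, status: disputed] -/
def relPermRegion (ρ : Equiv.Perm A) (q : RatPlace) (T : ∀ π : Portion F A q, (relPortionDatum σ τ A q π).Adm) :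
    ∀ π : Portion F A q, (relPortionDatum σ τ A q π).Adm :=
  fun π => ⟨relPermIso σ τ A ρ q π '' (T (portionPerm F A q ρ π)).1,
    isAdm_image_relPermIso σ τ A ρ q π (T (portionPerm F A q ρ π)).2⟩

/-- **[IUTchIII] Prop. 3.9 (i) at the relative genuine model: `μ^log_{A,v_ℚ}` is invariant with respect to permutations of
`A`** — `μ^log_{A,v_ℚ}(ρ·T) = μ^log_{A,v_ℚ}(T)` for every region `T` of the `A`-packet `⊕_{(v_β)} ⊗_β K_{v̲_β}` at `v_ℚ` and
every `ρ ∈ 𝔖_A` (portion log-volumes transported, weights symmetric — d3's `portionWeight_portionPerm` —, sum re-indexed).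
[claim: Mochizuki2012, status: disputed] -/
theorem relCapsulePacketLogVolume_relPermRegion (ρ : Equiv.Perm A) (q : RatPlace)
    (T : ∀ π : Portion F A q, (relPortionDatum σ τ A q π).Adm) :
    relCapsulePacketLogVolume σ τ A q (relPermRegion σ τ A ρ q T) = relCapsulePacketLogVolume σ τ A q T := by
  unfold relCapsulePacketLogVolume
  have h : ∀ π : Portion F A q,
      portionWeight F A q π * (relPortionDatum σ τ A q π).logVol (relPermRegion σ τ A ρ q T π).1 =
        portionWeight F A q (portionPerm F A q ρ π) *
          (relPortionDatum σ τ A q (portionPerm F A q ρ π)).logVol (T (portionPerm F A q ρ π)).1 := by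
    intro π
    rw [portionWeight_portionPerm]
    exact congrArg _ (logVol_image_relPermIso σ τ A ρ q π _)
  simp_rw [h]
  exact Equiv.sum_comp (portionPerm F A q ρ)
    (fun π => portionWeight F A q π * (relPortionDatum σ τ A q π).logVol (T π).1)

/-- **The permuted GLOBAL region** `ρ·S` (same packet log-volumes, hence still "zero for all but finitely many `v_ℚ`").
[claim: Mochizuki2012, status: disputed] -/
def relPermGlobalRegion (ρ : Equiv.Perm A) (S : GlobalRegion (relCapsulePacketLogVolume σ τ A)) :
    GlobalRegion (relCapsulePacketLogVolume σ τ A) :=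
  ⟨fun q => relPermRegion σ τ A ρ q (S.1 q), by
    refine S.2.subset fun q hq => ?_
    rw [Function.mem_support, relCapsulePacketLogVolume_relPermRegion] at hq
    exact Function.mem_support.mpr hq⟩

/-- **IUTchIII:Prop3.9(iii)** (kurims p. 117) PERMUTATION CLAUSE AT THE RELATIVE GENUINE MODEL (row REL39 part R3; node
IUTchIII:Prop3.9(iii)): for every `K ⊇ F_mod`, every section of places and every finite nonempty `A`, the global log-volume
`μ^log_{A,𝕍_ℚ}` of the `A`-packets `⊕_{(v_β)} ⊗_β K_{v̲_β}` is "invariant … with respect to permutations of `A`" —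
`μ^log_{A,𝕍_ℚ}(ρ·S) = μ^log_{A,𝕍_ℚ}(S)` for every global region `S` and every `ρ ∈ 𝔖_A`. [claim: Mochizuki2012, status: disputed] -/
theorem globalLogVolume_relPermGlobalRegion (ρ : Equiv.Perm A) (S : GlobalRegion (relCapsulePacketLogVolume σ τ A)) :
    globalLogVolume (relCapsulePacketLogVolume σ τ A) (relPermGlobalRegion σ τ A ρ S) =
      globalLogVolume (relCapsulePacketLogVolume σ τ A) S := by
  unfold globalLogVolume
  exact finsum_congr fun q => relCapsulePacketLogVolume_relPermRegion σ τ A ρ q (S.1 q)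

include hτ in
/-- **Both symmetries of (iii) together at the relative model**: the global log-volume is invariant under permuting the
labels AND multiplying by `f ∈ F_mod^×` in any label (part I `globalLogVolume_relCapsulePacketAction`).
[claim: Mochizuki2012, status: disputed] -/
theorem globalLogVolume_relPermGlobalRegion_relCapsulePacketAction (ρ : Equiv.Perm A) (α : A) (f : Fˣ)
    (S : GlobalRegion (relCapsulePacketLogVolume σ τ A)) :
    globalLogVolume (relCapsulePacketLogVolume σ τ A) (relPermGlobalRegion σ τ A ρ (relCapsulePacketAction σ τ hτ A α f S)) =
      globalLogVolume (relCapsulePacketLogVolume σ τ A) S := by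
  rw [globalLogVolume_relPermGlobalRegion, globalLogVolume_relCapsulePacketAction]

end Literature.IUT.LogThetaLattice

end
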